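import Summits.AtomisticToContinuum.Crystallization.Theorems.HolmgrenBoyleLindGroundStatesChargeFLCEquilibriumGroundStateNearForce
import Summits.AtomisticToContinuum.Crystallization.Theorems.HolmgrenBoyleLindGroundStatesChargeFLCEquilibriumNearFieldTransfer
import Summits.AtomisticToContinuum.Crystallization.Theorems.HolmgrenBoyleLindGroundStatesChargeFLCEquilibriumHasSumZeroOfPartialSums

/-!
# Crux `HolmgrenBoyleLind.GroundStatesChargeFLCEquilibrium` (stmt-AtomisticToContinuum-6076):
# finite-`N` criticality ⇒ exact force balance of a charged separated set

`forceBalanceOfChargedPatches` — the "force balance of local limits is automatic from finite-`N`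
criticality" half of the crux, UNCONDITIONALLY: if the patches of a `δ'`-separated set `Λ ⊂ ℝ³`
at ONE base point `q₀ ∈ Λ` are two-way `(R, ε)`-matched, at every scale, by neighbourhoods of
particles of Lennard-Jones ground states (after a linear isometry), then `Λ` is in exact
Lennard-Jones force balance at EVERY point: `Σ_{y ∈ Λ, y ≠ q} V′(|q − y|)(q − y)/|q − y| = 0` as a
`HasSum`. It is the composition of the three landed stubs of the line `registered` of the crux
(skeleton `Cruxes/GroundStatesChargeFLCEquilibrium/Lines/birth.lean`, glue
`forceBalanceOfChargedPatches_of_stubs`): `stub_groundStateNearForce` (Fermat `∇E = 0` at every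
particle + the `O(ρ⁻⁴)` far-field tail inside ground states, uniform hard core),
`stub_nearFieldTransfer` (matching + uniform continuity of the pair force at fixed radius ⇒ the
ball partial sums of the force series of `Λ` are `O(R⁻⁴)`) and `stub_hasSumZeroOfPartialSums`
(absolute summability turns that into `HasSum … 0`). Used by the conditional reduction of the
crux to the shared hinge `GroundStatesChargePeriodic` (item 2911). [folklore]
-/

noncomputable section

namespace Summit.AtomisticToContinuum.Crystallization.Theorems.HolmgrenBoyleLindGroundStatesChargeFLCEquilibrium

open Literature.MathematicalPhysics.StatisticalMechanics

/-- **Finite-`N` criticality ⇒ force balance of the charged set.** Let `Λ ⊂ ℝ³` be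
`δ'`-separated and `q₀ ∈ Λ`. If for all `R, ε > 0` some particle `i` of some Lennard-Jones ground
state `x` (any `N`) has its `R`-neighbourhood two-way `ε`-matched with `x_i + A(Λ − q₀)` for some
linear isometry `A`, then `Λ` is in exact Lennard-Jones force balance at every point `q ∈ Λ`.
Proof: the ground-state witnesses are uniformly separated with the near-field force bound
(`stub_groundStateNearForce`); the transfer (`stub_nearFieldTransfer`) bounds the ball partial sums
of the force series at every `q ∈ Λ` by `C'/R⁴`; `stub_hasSumZeroOfPartialSums` concludes.
[folklore] -/
theorem forceBalanceOfChargedPatches :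
    ∀ (Λ : Set (EuclideanSpace ℝ (Fin 3))) (δ' : ℝ), 0 < δ' →
      (∀ x ∈ Λ, ∀ y ∈ Λ, x ≠ y → δ' ≤ dist x y) → ∀ q₀ ∈ Λ,
      (∀ R ε : ℝ, 0 < R → 0 < ε →
        ∃ (N : ℕ) (x : Fin N → EuclideanSpace ℝ (Fin 3)) (i : Fin N)
          (A : EuclideanSpace ℝ (Fin 3) →ₗᵢ[ℝ] EuclideanSpace ℝ (Fin 3)),
          IsGroundState lennardJones x ∧
          (∀ s ∈ Λ, dist s q₀ ≤ R → ∃ j : Fin N, dist (x j) (x i + A (s - q₀)) ≤ ε) ∧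
          (∀ j : Fin N, dist (x j) (x i) ≤ R → ∃ s ∈ Λ, dist (x j) (x i + A (s - q₀)) ≤ ε)) →
      ∀ q ∈ Λ, HasSum (fun y : {y : EuclideanSpace ℝ (Fin 3) // y ∈ Λ ∧ y ≠ q} =>
        (deriv lennardJones (dist q (y : EuclideanSpace ℝ (Fin 3))) /
          dist q (y : EuclideanSpace ℝ (Fin 3))) • (q - (y : EuclideanSpace ℝ (Fin 3)))) 0 := by
  intro Λ δ' hδ' hsep q₀ hq₀ H q hq
  obtain ⟨δ₀, C, hδ₀, hGS⟩ := stub_groundStateNearForce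
  have H' : ∀ R ε : ℝ, 0 < R → 0 < ε →
      ∃ (N : ℕ) (x : Fin N → EuclideanSpace ℝ (Fin 3)) (i : Fin N)
        (A : EuclideanSpace ℝ (Fin 3) →ₗᵢ[ℝ] EuclideanSpace ℝ (Fin 3)),
        (∀ a b : Fin N, a ≠ b → δ₀ ≤ dist (x a) (x b)) ∧
        (∀ (k : Fin N) (ρ : ℝ), 1 ≤ ρ → ∀ B : Finset (Fin N), k ∉ B →
          (∀ j : Fin N, j ≠ k → dist (x j) (x k) < ρ → j ∈ B) →
          ‖∑ j ∈ B, (deriv lennardJones (dist (x k) (x j)) / dist (x k) (x j)) • (x k - x j)‖ ≤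
            C / ρ ^ 4) ∧
        (∀ s ∈ Λ, dist s q₀ ≤ R → ∃ j : Fin N, dist (x j) (x i + A (s - q₀)) ≤ ε) ∧
        (∀ j : Fin N, dist (x j) (x i) ≤ R → ∃ s ∈ Λ, dist (x j) (x i + A (s - q₀)) ≤ ε) := by
    intro R ε hR hε
    obtain ⟨N, x, i, A, hx, h1, h2⟩ := H R ε hR hε
    exact ⟨N, x, i, A, (hGS N x hx).1, (hGS N x hx).2, h1, h2⟩
  obtain ⟨C', hC'⟩ := stub_nearFieldTransfer Λ δ' hδ' hsep q₀ hq₀ δ₀ C hδ₀ H'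
  exact stub_hasSumZeroOfPartialSums Λ δ' hδ' hsep q hq ⟨C', hC' q hq⟩

end Summit.AtomisticToContinuum.Crystallization.Theorems.HolmgrenBoyleLindGroundStatesChargeFLCEquilibrium

end
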